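import Literature.Topology.FourManifolds.TautFoliationsRingCrossings
import HarnessLib

/-!
# Ring pieces between consecutive crossings lie in one square — any grid

Sibling of `TautFoliationsRingCrossings.lean`: `exists_sq_of_consecutive` is stated there for the
grid of `closedBall c₀ L` and the ring about the same `c₀`; here the grid is arbitrary and the
ring about `c₀` is only assumed to lie in the grid region (`OffCollar*` files: polar centre off
the grid centre). The proof is the same (the square index is locally constant along the ring off
the skeleton).

* `SquarePolar.exists_sq_of_consecutive'` (**proved**).

All statements are [folklore].
-/

noncomputable section

open Set Filter Metric Topology Function Real

namespace Literature.Topology.FourManifolds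

namespace SquarePolar

open SquareGrid SquareGrid.Grid

variable {c₀ : ℝ × ℝ} {R : ℝ}

/-- **Between consecutive crossing parameters the ring runs in one closed square**, for any grid
whose region contains the ring. [folklore] -/
theorem exists_sq_of_consecutive' (g : Grid) (hS : ∀ θ, ringParam c₀ R θ ∈ g.S) {θ₁ θ₂ : ℝ} (h12 : θ₁ < θ₂)
    (hno : ∀ θ ∈ Ioo θ₁ θ₂, ringParam c₀ R θ ∉ g.skeleton) :
    ∃ q, ringParam c₀ R '' Icc θ₁ θ₂ ⊆ g.sq q := by
  have hn : 0 < g.n := g.hn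
  -- the open square containing the ring point, for parameters strictly between
  have hball : ∀ θ ∈ Ioo θ₁ θ₂, ∃ q, ringParam c₀ R θ ∈ ball (g.centre q) g.ℓ := fun θ hθ ↦ by
    obtain ⟨q, hq⟩ := g.exists_mem_sq (hS θ)
    refine ⟨q, ?_⟩
    rcases (mem_closedBall.1 hq).lt_or_eq with hlt | heq
    · exact mem_ball.2 hlt
    · exact absurd ((g.mem_skeleton_iff).2 ⟨q, mem_sphere.2 heq⟩) (hno θ hθ)
  classical
  haveI : Nonempty (Fin g.n × Fin g.n) := ⟨(⟨0, hn⟩, ⟨0, hn⟩)⟩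
  choose! qf hqf using hball
  have hcont : ContinuousOn qf (Ioo θ₁ θ₂) := by
    intro θ hθ
    have hopen : IsOpen ((ringParam c₀ R) ⁻¹' ball (g.centre (qf θ)) g.ℓ) := isOpen_ball.preimage (continuous_ringParam c₀ R)
    have hev : ∀ᶠ θ' in 𝓝[Ioo θ₁ θ₂] θ, qf θ' = qf θ := by
      have h1 : ∀ᶠ θ' in 𝓝[Ioo θ₁ θ₂] θ, ringParam c₀ R θ' ∈ ball (g.centre (qf θ)) g.ℓ :=
        nhdsWithin_le_nhds (hopen.mem_nhds (hqf θ hθ))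
      have h2 : ∀ᶠ θ' in 𝓝[Ioo θ₁ θ₂] θ, θ' ∈ Ioo θ₁ θ₂ := self_mem_nhdsWithin
      filter_upwards [h1, h2] with θ' hθ' hθ'I
      exact g.eq_of_mem_ball_of_mem_ball hθ' (hqf θ' hθ'I)
    exact (continuousWithinAt_const (b := qf θ)).congr_of_eventuallyEq hev rfl
  have hconst : ∀ θ ∈ Ioo θ₁ θ₂, ∀ θ' ∈ Ioo θ₁ θ₂, qf θ = qf θ' := fun θ hθ θ' hθ' ↦
    isPreconnected_Ioo.constant hcont hθ hθ'
  set θm := (θ₁ + θ₂) / 2 with hθm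
  have hθmI : θm ∈ Ioo θ₁ θ₂ := ⟨by rw [hθm]; linarith, by rw [hθm]; linarith⟩
  refine ⟨qf θm, ?_⟩
  have hIoo : ringParam c₀ R '' Ioo θ₁ θ₂ ⊆ g.sq (qf θm) := by
    rintro _ ⟨θ, hθ, rfl⟩
    rw [← hconst θ hθ θm hθmI]
    exact ball_subset_closedBall (hqf θ hθ)
  have hcl : ringParam c₀ R '' Icc θ₁ θ₂ ⊆ closure (ringParam c₀ R '' Ioo θ₁ θ₂) := by
    rw [← closure_Ioo h12.ne]
    exact image_closure_subset_closure_image (continuous_ringParam c₀ R)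
  exact hcl.trans (closure_minimal hIoo isClosed_closedBall)

end SquarePolar

end Literature.Topology.FourManifolds
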